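import Literature.AnabelianGeometry.EtaleTheta.Discharge.Sec3Thm37Holds
import Literature.AnabelianGeometry.EtaleTheta.RealifiedDivisorMonoidsOfRlfR
import Literature.AlgebraicGeometry.Frobenioids.ModelFrobenioidUnits
import Literature.AlgebraicGeometry.Frobenioids.BaseFrobeniusSections
import Literature.AlgebraicGeometry.Frobenioids.EquivalenceUnitsTransport
import Mathlib.Topology.Algebra.ClopenNhdofOne
import HarnessLib

/-!
# [EtTh] Theorem 3.7 (i) «unit-trivial type (Λ = ℝ)» and the input `hdiv` of (iv), discharged

Proof-only sequel (theorems only, no definitions) of `Discharge/Sec3Thm37Holds.lean` (abc-iut-L6-t13 /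
abc-iut-L1-t1) for the sub-DAG `plan/L2/SUBDAG-EtTh-Thm37.md` (abc-iut-w5-d164), rows
`EtTh:Thm3.7(i)/L05`, `/L07`, `EtTh:Thm3.7(iv)/L13`, `/L00R`, `/L00Z`.  S. Mochizuki, *The étale theta
function …*, Publ. RIMS **45** (2009) [EtTh], §3, Theorem 3.7, pp. 305–306 = PDF pp. 79–80 of
`paper:doi-10-2977-prims-1234361159`; the printed proof (p. 306 ll. 4–6 and 14–16):

> "By Proposition 3.4, (ii) (respectively, by the definition of the realification of a Frobenioid —
> cf. [Mzk17], Proposition 5.3), it follows that if, moreover, `Λ = ℤ` (respectively, `Λ = ℝ`), then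
> `C` is of unit-profinite (respectively, unit-trivial) type … Assertion (iv) follows formally from
> [Mzk17], Proposition 1.13, (iii) [since, by assertion (i) of the present Theorem 3.7, “condition (b)”
> of loc. cit. is always satisfied by objects of `C`]."

What is kernel-checked here.
* (L05) For an object `A = (A_D, ·)` of the tempered Frobenioid `C = C₀.category` (the model Frobenioid
  of the data `(D, Φ, B, B → Φ^gp)`, Def. 3.6 (ii)), the rational function `u_σ ∈ B(A_D)` of a unit
  `σ ∈ O^×(A)` has `B₀^Λ`-component in the KERNEL of `B₀^Λ(Y_A) → (Φ₀^ℝ)^gp(Y_A)`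
  (`fst_unitsToRatFn_mem_ker`; [FrdI] Thm 5.2 (ii) "`O^×(−)` on `C^birat` is `B`", L1's
  `ModelFrobenioid.unitsToRatFn`, and `B = B₀^Λ|_D ×_{(Φ^{ℝ-log})^gp} Φ^gp`).
* (L07) **Thm 3.7 (i), "`C` is of unit-trivial type" for `Λ = ℝ`** — exactly print's route "by the
  definition of the realification": when `B₀^Λ → (Φ₀^ℝ)^gp` is injective (Def. 3.6 (i):
  `B₀^ℝ := ℝ·Φ₀^birat ⊆ (Φ₀^ℝ)^gp` IS a subgroup) the kernel is trivial, so `O^×(A) = 1`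
  (`thm37_i_unitTrivial_of_divΛ_injective`, modulo `hF` = [FrdI] Thm 5.2 (ii) and the injectivity
  `hinj`).  The schema `RealifiedDivisorMonoids` keeps `B₀^Λ` abstract and does not record `hinj`; for
  the CONSTRUCTED data `RealifiedDivisorMonoids.ofRlfR` (abc-iut-L6-t12) `divΛ` is the inclusion, so
  `hinj` is discharged there (`ofRlfR_divΛ_injective`, `thm37_i_unitTrivial_ofRlfR`), and at the
  canonical [FrdI] vocabulary `treeCatVocab` modulo L1-t1's single residual datum `hBmon : IsMonoidOn B`.
* (L13) the input `hdiv` ("`⋂ₙ O^×(A)ⁿ = 1`") of the landed (iv)-theorems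
  (`isSlim_category_of_isFrobenioid`, `thm37_iv_of_isFrobenioid`) — the ONLY place where print's
  restriction "`Λ ∈ {ℤ, ℝ}`" enters (iv): for `Λ = ℝ` from unit-triviality; for `Λ = ℤ` from
  unit-profinite type via the general lemma «a group carrying a profinite group topology has no
  non-trivial divisible element» (`IsTfgProfinite.eq_one_of_forall_exists_pow_eq`: for every open
  normal subgroup `U`, of finite index `m`, `α = β^m ∈ U`; `⋂ U = 1`), whence
  `PreFrobenioid.hdiv_of_isOfUnitProfiniteType` for ANY pre-Frobenioid of unit-profinite type
  ([FrdI] Def 2.8 (i), L1's REAL predicate `PreFrobenioid.IsOfUnitProfiniteType`).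
* (L00R/L00Z) **Thm 3.7 (iv)** (L2-t3's named `Prop` `Thm37_iv`) modulo `hF` and `hinj` (resp.
  unit-profinite type); OUTRIGHT modulo `hF` (resp. `hBmon` at `treeCatVocab`) over `ofRlfR` data; and
  the two unit conjuncts of L2-t3's `Thm37_i F` for such data and ANY facade `F`.
* (L06) `O^×(A) ≅ Ker(B₀^Λ(Y_A)^× → (Φ₀^ℝ)^gp(Y_A))` and "unit-profinite type" (`Λ = ℤ`) MODULO the datum
  that these kernels admit a tfg profinite topology (print: Prop. 3.4 (ii) `Ker ≅ O_L^×`; the typed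
  `DivisorMonoids.Prop34` records only "kernel ⊆ constants").  NOT here: "model type" (w4-d103); (iii).
HONEST FRAMING: refereed pre-IUT material; nothing here bears on [IUTchIII] Cor. 3.12.
-/

namespace Literature.AlgebraicGeometry.Frobenioids

open CategoryTheory

universe u
/-! ## A group with a profinite group topology has no non-trivial divisible element -/

/-- In a (topologically finitely generated) profinite group an element admitting an `n`-th root for
every `n ≥ 1` is trivial: for every open normal subgroup `U` (of finite index `m`, by compactness)
`z = y^m ∈ U`, and the open normal subgroups form a neighbourhood basis of `1` in a Hausdorff space.
(Finite generation is not used.) [cite: MochizukiFrdI2008, Def. 2.8(i) p.52] -/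
theorem IsTfgProfinite.eq_one_of_forall_exists_pow_eq {M : Type u} [Group M] [TopologicalSpace M]
    (h : IsTfgProfinite M) {z : M} (hz : ∀ n : ℕ+, ∃ y : M, y ^ (n : ℕ) = z) : z = 1 := by
  haveI := h.isTopologicalGroup
  haveI := h.compactSpace
  haveI := h.totallyDisconnectedSpace
  haveI := h.t2Space
  by_contra hne
  obtain ⟨N, hN⟩ := ProfiniteGrp.exist_openNormalSubgroup_sub_open_nhds_of_one
    (isOpen_compl_singleton (x := z)) (Set.mem_compl_singleton_iff.mpr (Ne.symm hne))
  haveI : (N : Subgroup M).FiniteIndex := Subgroup.finiteIndex_of_finite_quotient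
  obtain ⟨y, hy⟩ := hz ⟨(N : Subgroup M).index, Nat.pos_of_ne_zero Subgroup.FiniteIndex.index_ne_zero⟩
  have hzN : z ∈ (N : Subgroup M) := by
    rw [← hy]
    exact (N : Subgroup M).pow_index_mem y
  exact hN hzN rfl

/-- A group that admits a (tfg) profinite topology has no non-trivial divisible element.
[cite: MochizukiFrdI2008, Def. 2.8(i) p.52] -/
theorem AdmitsTfgProfiniteTopology.eq_one_of_forall_exists_pow_eq {M : Type u} [Group M]
    (h : AdmitsTfgProfiniteTopology M) {z : M} (hz : ∀ n : ℕ+, ∃ y : M, y ^ (n : ℕ) = z) : z = 1 := by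
  obtain ⟨t, ht⟩ := h
  exact @IsTfgProfinite.eq_one_of_forall_exists_pow_eq M _ t ht z hz

namespace PreFrobenioid

universe uC vC uD vD w

variable {C : Type uC} [Category.{vC} C] {D : Type uD} [Category.{vD} D] {Φ : Dᵒᵖ ⥤ CommMonCat.{w}}
  (F : C ⥤ ElemFrobenioid Φ)

/-- For a pre-Frobenioid of **unit-profinite type** ([FrdI] Def 2.8 (i)) the unit groups `O^×(A)` have
no non-trivial divisible element: `α ∈ O^×(A)` with an `n`-th root in `O^×(A)` for every `n ≥ 1` is the
identity — the hypothesis `hdiv` of [FrdI] Prop 1.13 (iii) / [EtTh] Thm 3.7 (iv) as used by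
`TemperedFrobenioid.isSlim_category_of_isFrobenioid`. [cite: MochizukiFrdI2008, Def. 2.8(i) p.52] -/
theorem hdiv_of_isOfUnitProfiniteType (h : IsOfUnitProfiniteType F) :
    ∀ (X : C) (α : Aut X), α ∈ unitsSubgroup F X →
      (∀ n : ℕ+, ∃ β : Aut X, β ∈ unitsSubgroup F X ∧ β ^ (n : ℕ) = α) → α = 1 := by
  intro X α hα hroots
  have key : (⟨α, hα⟩ : unitsSubgroup F X) = 1 :=
    (h X).eq_one_of_forall_exists_pow_eq fun n => by
      obtain ⟨β, hβ, hβn⟩ := hroots n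
      exact ⟨⟨β, hβ⟩, Subtype.ext (by rw [Subgroup.coe_pow]; exact hβn)⟩
  exact congrArg Subtype.val key

/-- For a pre-Frobenioid of **unit-trivial type** the hypothesis `hdiv` holds trivially.
[cite: MochizukiFrdI2008, Def. 1.2(iv) p.24] -/
theorem hdiv_of_isUnitTrivial (h : IsOfType (IsUnitTrivial F)) :
    ∀ (X : C) (α : Aut X), α ∈ unitsSubgroup F X →
      (∀ n : ℕ+, ∃ β : Aut X, β ∈ unitsSubgroup F X ∧ β ^ (n : ℕ) = α) → α = 1 :=
  fun X α hα _ => h X α hα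

end PreFrobenioid

end Literature.AlgebraicGeometry.Frobenioids

namespace Literature.AnabelianGeometry.EtaleTheta

open CategoryTheory Opposite Literature.AlgebraicGeometry.Frobenioids

universe u₀ v₀ u v w

namespace TemperedFrobenioid

section General

variable {D₀ : Type u₀} [Category.{v₀} D₀] {V : FrdIMonoidStub.{w}}
  {T : RealifiedDivisorMonoids (D₀ := D₀) V} {D : Type u} [Category.{v} D]
  {VD : FrdICatStub.{u, v, w} D} (C₀ : TemperedFrobenioid T D VD)

/-- `O^×(A)` of [FrdI] Def 1.2 (ii) for the structure functor `C → F_Φ` of the tempered Frobenioid is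
L1's `ModelFrobenioid.units A` (same carrier). [cite: MochizukiEtTh2009, Def 3.6 p.77] -/
theorem unitsSubgroup_toElem_eq_units (X : C₀.category) :
    PreFrobenioid.unitsSubgroup C₀.toElem X = ModelFrobenioid.units X :=
  SetLike.ext fun _ => Iff.rfl

/-- **(L05)** The `B₀^Λ`-component of the rational function `u_σ ∈ B(A_D) = B₀^Λ(Y_A) ×_{(Φ^{ℝ-log})^gp}
Φ(A_D)^gp` of a unit `σ ∈ O^×(A)` lies in the kernel of `B₀^Λ(Y_A) → (Φ₀^ℝ)^gp(Y_A)`: `Div_B(u_σ) = 0`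
([FrdI] Thm 5.2 (ii), `Φ(A_D)` sharp) and the fibre-product condition. [cite: MochizukiEtTh2009, Thm 3.7 p.79] -/
theorem fst_unitsToRatFn_mem_ker (hF : PreFrobenioid.IsFrobenioid C₀.toElem) (X : C₀.category)
    (a : ModelFrobenioid.units X) :
    T.divΛ (C₀.baseOp (op X.base))
      ((ModelFrobenioid.unitsToRatFn X a : C₀.ratFnFunctor.obj (op X.base)) :
        C₀.ratFn (op X.base)).1.1 = 1 := by
  have hΦ : IsDivisorial (C₀.divisorMonoid.obj (op X.base)) := hF.isPreFrobenioid.isDivisorial X.base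
  set p : C₀.ratFn (op X.base) :=
    (ModelFrobenioid.unitsToRatFn X a : C₀.ratFnFunctor.obj (op X.base)) with hp
  have h1 : Literature.AlgebraicGeometry.Frobenioids.divB C₀.divisorMonoid C₀.ratFnFunctor C₀.divBNatTrans (op X.base)
      (ModelFrobenioid.unitsToRatFn X a : C₀.ratFnFunctor.obj (op X.base)) = 1 :=
    ModelFrobenioid.divB_unitsToRatFn_eq_one hΦ.isSharp a
  have h2 : p.1.2 = 1 := h1
  rw [p.2, h2, map_one]

/-- **(L07) Thm 3.7 (i), "`C` is of unit-trivial type" (the case `Λ = ℝ`)**, along print's route "by the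
definition of the realification": if `B₀^Λ(Y) → (Φ₀^ℝ)^gp(Y)` is injective for every `Y` under an object
of `D` (Def. 3.6 (i): `B₀^ℝ := ℝ·Φ₀^birat ⊆ (Φ₀^ℝ)^gp`), then every `O^×(A)` is trivial.  Modulo `hF`
([FrdI] Thm 5.2 (ii): `C → F_Φ` is a Frobenioid, giving `Φ(A_D)` sharp and integral).
[cite: MochizukiEtTh2009, Thm 3.7 p.79] -/
theorem thm37_i_unitTrivial_of_divΛ_injective (hF : PreFrobenioid.IsFrobenioid C₀.toElem)
    (hinj : ∀ A : Dᵒᵖ, Function.Injective (T.divΛ (C₀.baseOp A))) :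
    PreFrobenioid.IsOfType (PreFrobenioid.IsUnitTrivial C₀.toElem) := by
  intro X α hα
  have hΦ : IsDivisorial (C₀.divisorMonoid.obj (op X.base)) := hF.isPreFrobenioid.isDivisorial X.base
  let a : ModelFrobenioid.units X := ⟨α, hα⟩
  set p : C₀.ratFn (op X.base) :=
    (ModelFrobenioid.unitsToRatFn X a : C₀.ratFnFunctor.obj (op X.base)) with hp
  have h1 : Literature.AlgebraicGeometry.Frobenioids.divB C₀.divisorMonoid C₀.ratFnFunctor C₀.divBNatTrans (op X.base)
      (ModelFrobenioid.unitsToRatFn X a : C₀.ratFnFunctor.obj (op X.base)) = 1 :=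
    ModelFrobenioid.divB_unitsToRatFn_eq_one hΦ.isSharp a
  have h2 : p.1.2 = 1 := h1
  have h3 : p.1.1 = 1 := by
    apply hinj (op X.base)
    rw [map_one, p.2, h2, map_one]
  have h4 : p = 1 := Subtype.ext (Prod.ext h3 h2)
  have h5 : ModelFrobenioid.unitsToRatFn X a = 1 := Units.val_eq_one.mp h4
  have h6 : a = 1 :=
    ModelFrobenioid.unitsToRatFn_injective hΦ.isPreDivisorial.isIntegral (by rw [h5, map_one])
  exact congrArg Subtype.val h6

/-- Under the same injectivity every `O^×(A)` is the trivial subgroup. [cite: MochizukiEtTh2009, Thm 3.7 p.79] -/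
theorem unitsSubgroup_eq_bot_of_divΛ_injective (hF : PreFrobenioid.IsFrobenioid C₀.toElem)
    (hinj : ∀ A : Dᵒᵖ, Function.Injective (T.divΛ (C₀.baseOp A))) (X : C₀.category) :
    PreFrobenioid.unitsSubgroup C₀.toElem X = ⊥ :=
  (Subgroup.eq_bot_iff_forall _).2 (C₀.thm37_i_unitTrivial_of_divΛ_injective hF hinj X)

/-- **(L13, Λ = ℝ) + (L00)  Thm 3.7 (iv)** "`D` slim ⟹ `C` slim" modulo `hF` and the injectivity of
`B₀^Λ → (Φ₀^ℝ)^gp` only: the input `hdiv` of `isSlim_category_of_isFrobenioid` holds because the unit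
groups are trivial. [cite: MochizukiEtTh2009, Thm 3.7 p.80] -/
theorem isSlim_category_of_divΛ_injective (hF : PreFrobenioid.IsFrobenioid C₀.toElem)
    (hinj : ∀ A : Dᵒᵖ, Function.Injective (T.divΛ (C₀.baseOp A))) (hD : IsSlim D) :
    IsSlim C₀.category :=
  C₀.isSlim_category_of_isFrobenioid hF
    (PreFrobenioid.hdiv_of_isUnitTrivial C₀.toElem (C₀.thm37_i_unitTrivial_of_divΛ_injective hF hinj)) hD

/-- **Thm 3.7 (iv)** as L2-t3's named `Prop` `Thm37_iv`, modulo `hF` and the injectivity of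
`B₀^Λ → (Φ₀^ℝ)^gp` (the case `Λ = ℝ` of the data). [cite: MochizukiEtTh2009, Thm 3.7 p.80] -/
theorem thm37_iv_of_divΛ_injective (hF : PreFrobenioid.IsFrobenioid C₀.toElem)
    (hinj : ∀ A : Dᵒᵖ, Function.Injective (T.divΛ (C₀.baseOp A))) : C₀.Thm37_iv :=
  C₀.thm37_iv_of_isFrobenioid hF
    (PreFrobenioid.hdiv_of_isUnitTrivial C₀.toElem (C₀.thm37_i_unitTrivial_of_divΛ_injective hF hinj))

/-- **(L13, Λ = ℤ) + (L00Z)  Thm 3.7 (iv)** modulo `hF` and "`C` is of unit-profinite type" ([FrdI] Def 2.8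
(i), L1's real predicate; = the `Λ = ℤ` clause of Thm 3.7 (i)): a profinite group has no non-trivial
divisible element, so `hdiv` holds. [cite: MochizukiEtTh2009, Thm 3.7 p.80] -/
theorem thm37_iv_of_isOfUnitProfiniteType (hF : PreFrobenioid.IsFrobenioid C₀.toElem)
    (hprof : PreFrobenioid.IsOfUnitProfiniteType C₀.toElem) : C₀.Thm37_iv :=
  C₀.thm37_iv_of_isFrobenioid hF (PreFrobenioid.hdiv_of_isOfUnitProfiniteType C₀.toElem hprof)

/-- The slimness conclusion, modulo `hF` and unit-profinite type. [cite: MochizukiEtTh2009, Thm 3.7 p.80] -/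
theorem isSlim_category_of_isOfUnitProfiniteType (hF : PreFrobenioid.IsFrobenioid C₀.toElem)
    (hprof : PreFrobenioid.IsOfUnitProfiniteType C₀.toElem) (hD : IsSlim D) : IsSlim C₀.category :=
  C₀.isSlim_category_of_isFrobenioid hF (PreFrobenioid.hdiv_of_isOfUnitProfiniteType C₀.toElem hprof) hD

/-! ### (L06) `O^×(A) ≅ Ker(B₀^Λ(Y_A)^× → (Φ₀^ℝ)^gp(Y_A))` and unit-profinite type from the kernel -/

/-- **(L05/L06) `O^×(A) ≅ Ker(B₀^Λ(Y_A)^× → (Φ₀^ℝ)^gp(Y_A))`** for every object `A` of the tempered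
Frobenioid (`B₀^Λ(Y)` is a group — every element is a unit, Def. 3.6 (i) — written here through its unit
group `B₀^Λ(Y)^×`): the group isomorphism `σ ↦ (B₀^Λ`-component of `u_σ)` ([FrdI] Thm 5.2 (ii)
"`O^×(−)` on `C^birat` is `B`" — injective by L1's `unitsToRatFn_injective`, onto the kernel by L1's
`unitAut` applied to `(b, 0) ∈ B(A_D) = B₀^Λ(Y_A) ×_{(Φ^{ℝ-log})^gp} Φ(A_D)^gp`).  Modulo `hF`.  This is the
map through which print's "By Proposition 3.4, (ii)" (`Ker ≅ O_L^×`) acts on Thm 3.7 (i).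
[cite: MochizukiEtTh2009, Thm 3.7 p.79] -/
theorem nonempty_units_mulEquiv_ker (hF : PreFrobenioid.IsFrobenioid C₀.toElem) (X : C₀.category) :
    Nonempty (ModelFrobenioid.units X ≃*
      ((T.divΛ (C₀.baseOp (op X.base))).comp
        (Units.coeHom (T.BΛ.obj (C₀.baseOp (op X.base))))).ker) := by
  have hΦ : IsDivisorial (C₀.divisorMonoid.obj (op X.base)) := hF.isPreFrobenioid.isDivisorial X.base
  -- the projection `B(A_D) → B₀^Λ(Y_A)` and the candidate map `σ ↦ (B₀^Λ-component of u_σ)`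
  let φ : C₀.ratFnFunctor.obj (op X.base) →* T.BΛ.obj (C₀.baseOp (op X.base)) :=
    (MonoidHom.fst _ _).comp (C₀.ratFn (op X.base)).subtype
  have hφ : ∀ q : C₀.ratFnFunctor.obj (op X.base), φ q = (q : C₀.ratFn (op X.base)).1.1 := fun _ => rfl
  -- the `Φ^gp`-component of `u_σ` is trivial, its `B₀^Λ`-component is in the kernel
  have hsnd : ∀ a : ModelFrobenioid.units X,
      ((ModelFrobenioid.unitsToRatFn X a : C₀.ratFnFunctor.obj (op X.base)) :
        C₀.ratFn (op X.base)).1.2 = 1 := fun a =>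
    (ModelFrobenioid.divB_unitsToRatFn_eq_one hΦ.isSharp a :)
  have hmem : ∀ a : ModelFrobenioid.units X,
      ((Units.map φ).comp (ModelFrobenioid.unitsToRatFn X)) a ∈
        ((T.divΛ (C₀.baseOp (op X.base))).comp
          (Units.coeHom (T.BΛ.obj (C₀.baseOp (op X.base))))).ker := fun a => by
    rw [MonoidHom.mem_ker, MonoidHom.comp_apply, MonoidHom.comp_apply, Units.coeHom_apply,
      Units.coe_map, hφ]
    exact C₀.fst_unitsToRatFn_mem_ker hF X a
  let θ := ((Units.map φ).comp (ModelFrobenioid.unitsToRatFn X)).codRestrict _ hmem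
  have hθ : ∀ a, ((θ a : ((T.divΛ (C₀.baseOp (op X.base))).comp
      (Units.coeHom (T.BΛ.obj (C₀.baseOp (op X.base))))).ker) :
        (T.BΛ.obj (C₀.baseOp (op X.base)))ˣ) = Units.map φ (ModelFrobenioid.unitsToRatFn X a) :=
    fun _ => rfl
  refine ⟨MulEquiv.ofBijective θ ⟨fun a b hab => ?_, fun b => ?_⟩⟩
  · -- injective
    have h0 : φ (ModelFrobenioid.unitsToRatFn X a : C₀.ratFnFunctor.obj (op X.base)) =
        φ (ModelFrobenioid.unitsToRatFn X b : C₀.ratFnFunctor.obj (op X.base)) := by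
      rw [← Units.coe_map, ← Units.coe_map, ← hθ, ← hθ, hab]
    have h1 : ((ModelFrobenioid.unitsToRatFn X a : C₀.ratFnFunctor.obj (op X.base)) :
        C₀.ratFn (op X.base)) =
        ((ModelFrobenioid.unitsToRatFn X b : C₀.ratFnFunctor.obj (op X.base)) : C₀.ratFn (op X.base)) :=
      Subtype.ext (Prod.ext (by rw [← hφ, ← hφ]; exact h0) (by rw [hsnd, hsnd]))
    exact ModelFrobenioid.unitsToRatFn_injective hΦ.isPreDivisorial.isIntegral (Units.ext h1)
  · -- surjective: `(b, 0) ∈ B(A_D)` for `b` in the kernel gives a unit of `A`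
    obtain ⟨bu, hb⟩ := b
    rw [MonoidHom.mem_ker, MonoidHom.comp_apply, Units.coeHom_apply] at hb
    have hb' : T.divΛ (C₀.baseOp (op X.base)) (↑bu⁻¹ : T.BΛ.obj (C₀.baseOp (op X.base))) = 1 := by
      have h := map_mul (T.divΛ (C₀.baseOp (op X.base)))
        (↑bu⁻¹ : T.BΛ.obj (C₀.baseOp (op X.base))) (↑bu : T.BΛ.obj (C₀.baseOp (op X.base)))
      rw [Units.inv_mul, map_one, hb, mul_one] at h
      exact h.symm
    let p : C₀.ratFn (op X.base) := ⟨((bu : T.BΛ.obj (C₀.baseOp (op X.base))), 1), by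
      change T.divΛ (C₀.baseOp (op X.base)) bu = C₀.ΦgpToRlog (op X.base) 1
      rw [map_one, hb]⟩
    let p' : C₀.ratFn (op X.base) := ⟨((↑bu⁻¹ : T.BΛ.obj (C₀.baseOp (op X.base))), 1), by
      change T.divΛ (C₀.baseOp (op X.base)) ↑bu⁻¹ = C₀.ΦgpToRlog (op X.base) 1
      rw [map_one, hb']⟩
    have h : Algebra.GrothendieckGroup.of (1 : C₀.divisorMonoid.obj (op X.base)) =
        Literature.AlgebraicGeometry.Frobenioids.divB C₀.divisorMonoid C₀.ratFnFunctor C₀.divBNatTrans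
          (op X.base) (p : C₀.ratFnFunctor.obj (op X.base)) := by
      rw [map_one]; rfl
    have h' : Algebra.GrothendieckGroup.of (1 : C₀.divisorMonoid.obj (op X.base)) =
        Literature.AlgebraicGeometry.Frobenioids.divB C₀.divisorMonoid C₀.ratFnFunctor C₀.divBNatTrans
          (op X.base) (p' : C₀.ratFnFunctor.obj (op X.base)) := by
      rw [map_one]; rfl
    have hu : (p' : C₀.ratFnFunctor.obj (op X.base)) * p = 1 :=
      Subtype.ext (Prod.ext (Units.inv_mul bu) (one_mul 1))
    let α : Aut X := ModelFrobenioid.unitAut X 1 1 (p : C₀.ratFnFunctor.obj (op X.base)) p' h h'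
      (one_mul 1) hu
    refine ⟨⟨α, ModelFrobenioid.unitAut_mem_units X 1 1 _ _ h h' (one_mul 1) hu⟩,
      Subtype.ext (Units.ext ?_)⟩
    rw [hθ, Units.coe_map, hφ]
    rfl

/-- The same isomorphism for `O^×(A)` in [FrdI] Def 1.2 (ii) form (`PreFrobenioid.unitsSubgroup`).
[cite: MochizukiEtTh2009, Thm 3.7 p.79] -/
theorem nonempty_unitsSubgroup_mulEquiv_ker (hF : PreFrobenioid.IsFrobenioid C₀.toElem)
    (X : C₀.category) :
    Nonempty (PreFrobenioid.unitsSubgroup C₀.toElem X ≃*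
      ((T.divΛ (C₀.baseOp (op X.base))).comp
        (Units.coeHom (T.BΛ.obj (C₀.baseOp (op X.base))))).ker) := by
  obtain ⟨e⟩ := C₀.nonempty_units_mulEquiv_ker hF X
  exact ⟨(MulEquiv.subgroupCongr (C₀.unitsSubgroup_toElem_eq_units X)).trans e⟩

/-- **(L06, modulo the kernel datum R1) Thm 3.7 (i), "`C` is of unit-profinite type" (the case
`Λ = ℤ`)** in L1's REAL [FrdI] Def 2.8 (i) vocabulary `PreFrobenioid.IsOfUnitProfiniteType`: it holds as
soon as each kernel `Ker(B₀^Λ(Y_A)^× → (Φ₀^ℝ)^gp(Y_A))` admits a topologically finitely generated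
profinite topology — print's "By Proposition 3.4, (ii)" (`Ker(B₀(Y) → Φ₀^gp(Y)) ≅ O_L^×`, a tfg profinite
group), a datum the typed `DivisorMonoids.Prop34` records only as "kernel ⊆ constants" (row L06 / residual
R1 of the sub-DAG).  Modulo `hF`. [cite: MochizukiEtTh2009, Thm 3.7 p.79] -/
theorem isOfUnitProfiniteType_of_ker (hF : PreFrobenioid.IsFrobenioid C₀.toElem)
    (hker : ∀ A : Dᵒᵖ, AdmitsTfgProfiniteTopology
      ((T.divΛ (C₀.baseOp A)).comp (Units.coeHom (T.BΛ.obj (C₀.baseOp A)))).ker) :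
    PreFrobenioid.IsOfUnitProfiniteType C₀.toElem := fun X => by
  obtain ⟨e⟩ := C₀.nonempty_unitsSubgroup_mulEquiv_ker hF X
  exact AdmitsTfgProfiniteTopology.of_mulEquiv e.symm (hker _)

/-- **Thm 3.7 (iv)** modulo `hF` and the kernel datum of L06 (the case `Λ = ℤ`).
[cite: MochizukiEtTh2009, Thm 3.7 p.80] -/
theorem thm37_iv_of_ker (hF : PreFrobenioid.IsFrobenioid C₀.toElem)
    (hker : ∀ A : Dᵒᵖ, AdmitsTfgProfiniteTopology
      ((T.divΛ (C₀.baseOp A)).comp (Units.coeHom (T.BΛ.obj (C₀.baseOp A)))).ker) : C₀.Thm37_iv :=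
  C₀.thm37_iv_of_isOfUnitProfiniteType hF (C₀.isOfUnitProfiniteType_of_ker hF hker)

end General

/-! ## The constructed data of monoid type `ℝ`: `RealifiedDivisorMonoids.ofRlfR` -/

section OfRlfR

variable {D₀ : Type u₀} [Category.{v₀} D₀] (dm : DivisorMonoids.{u₀, v₀, w} D₀)
  (hpf : ∀ Y : D₀ᵒᵖ, IsPerfFactorial (dm.Φ₀.obj Y))

/-- For the CONSTRUCTED Def. 3.6 (i) data of monoid type `ℝ` (`B₀^ℝ := ℝ·Φ₀^birat ⊆ (Φ₀^ℝ)^gp`) the map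
`B₀^ℝ(Y) → (Φ₀^ℝ)^gp(Y)` is the inclusion, hence injective (schema residual R2 of SUBDAG-EtTh-Thm37
discharged at the constructor). [cite: MochizukiEtTh2009, Def 3.6 p.76] -/
theorem _root_.Literature.AnabelianGeometry.EtaleTheta.RealifiedDivisorMonoids.ofRlfR_divΛ_injective
    (Y : D₀ᵒᵖ) : Function.Injective ((RealifiedDivisorMonoids.ofRlfR dm hpf).divΛ Y) :=
  fun _ _ h => Subtype.ext h

variable {D : Type u} [Category.{v} D]

section AnyVocab

variable {VD : FrdICatStub.{u, v, w} D}
  (C₀ : TemperedFrobenioid (RealifiedDivisorMonoids.ofRlfR dm hpf) D VD)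

/-- A tempered Frobenioid over `ofRlfR` data has monoid type `ℝ`. [cite: MochizukiEtTh2009, Def 3.6 p.77] -/
theorem monoidType_ofRlfR : C₀.monoidType = MonoidType.R := rfl

/-- **Thm 3.7 (i), "unit-trivial type", for every tempered Frobenioid of monoid type `ℝ` over the
constructed data `ofRlfR`**, modulo `hF` only. [cite: MochizukiEtTh2009, Thm 3.7 p.79] -/
theorem thm37_i_unitTrivial_ofRlfR (hF : PreFrobenioid.IsFrobenioid C₀.toElem) :
    PreFrobenioid.IsOfType (PreFrobenioid.IsUnitTrivial C₀.toElem) :=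
  C₀.thm37_i_unitTrivial_of_divΛ_injective hF fun A =>
    RealifiedDivisorMonoids.ofRlfR_divΛ_injective dm hpf (C₀.baseOp A)

/-- The two UNIT conjuncts of L2-t3's typed `Thm37_i F` ("if `Λ = ℤ` (resp. `Λ = ℝ`), then `C` is of
unit-profinite (resp. unit-trivial) type") for tempered Frobenioids over `ofRlfR` data and ANY facade `F`
(the `Λ = ℤ` conjunct is vacuous: the monoid type is `ℝ`), modulo `hF`. [cite: MochizukiEtTh2009, Thm 3.7 p.79] -/
theorem thm37_i_unitConjuncts_ofRlfR (F : FrobenioidFacade.{u, v, w} D)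
    (hF : PreFrobenioid.IsFrobenioid C₀.toElem) :
    (C₀.monoidType = MonoidType.Z → F.IsOfUnitProfiniteType C₀.toElem) ∧
      (C₀.monoidType = MonoidType.R →
        PreFrobenioid.IsOfType (PreFrobenioid.IsUnitTrivial C₀.toElem)) :=
  ⟨fun h => absurd ((C₀.monoidType_ofRlfR dm hpf).symm.trans h) (by decide),
    fun _ => C₀.thm37_i_unitTrivial_ofRlfR dm hpf hF⟩

/-- **Thm 3.7 (iv) for every tempered Frobenioid of monoid type `ℝ` over `ofRlfR` data**, modulo `hF`
only (L2-t3's named `Prop` `Thm37_iv`). [cite: MochizukiEtTh2009, Thm 3.7 p.80] -/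
theorem thm37_iv_ofRlfR (hF : PreFrobenioid.IsFrobenioid C₀.toElem) : C₀.Thm37_iv :=
  C₀.thm37_iv_of_divΛ_injective hF fun A =>
    RealifiedDivisorMonoids.ofRlfR_divΛ_injective dm hpf (C₀.baseOp A)

end AnyVocab

section TreeVocab

variable {IsRational IsStrictlyRational : (Dᵒᵖ ⥤ CommMonCat.{w}) → Prop}
  (C₀ : TemperedFrobenioid (RealifiedDivisorMonoids.ofRlfR dm hpf) D
    (treeCatVocab D IsRational IsStrictlyRational))

/-- At the canonical [FrdI] vocabulary `treeCatVocab`: **Thm 3.7 (i) "unit-trivial type" for monoid type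
`ℝ` over `ofRlfR` data modulo the single residual datum `hBmon : IsMonoidOn B`** (`hF` being L1's PROVED
[FrdI] Thm 5.2 (ii)). [cite: MochizukiEtTh2009, Thm 3.7 p.79] -/
theorem thm37_i_unitTrivial_ofRlfR_treeCatVocab (hBmon : IsMonoidOn C₀.ratFnFunctor) :
    PreFrobenioid.IsOfType (PreFrobenioid.IsUnitTrivial C₀.toElem) :=
  C₀.thm37_i_unitTrivial_ofRlfR dm hpf (C₀.isFrobenioid_treeCatVocab_of_isMonoidOn hBmon)

/-- At `treeCatVocab`: **Thm 3.7 (iv) for monoid type `ℝ` over `ofRlfR` data modulo `hBmon` only.**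
[cite: MochizukiEtTh2009, Thm 3.7 p.80] -/
theorem thm37_iv_ofRlfR_treeCatVocab (hBmon : IsMonoidOn C₀.ratFnFunctor) : C₀.Thm37_iv :=
  C₀.thm37_iv_ofRlfR dm hpf (C₀.isFrobenioid_treeCatVocab_of_isMonoidOn hBmon)

end TreeVocab

end OfRlfR

end TemperedFrobenioid

end Literature.AnabelianGeometry.EtaleTheta
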